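import Literature.Algebra.Homology.DiscreteRepTateDuality
import Literature.Algebra.Homology.DiscreteRepTrivialDualityPrimary
import HarnessLib

/-!
# Tate's duality theorem at a prime `p` for a `P`-class-formation-like object of `C_Γ`
# (Harari Thm. 16.21 "restricted to `ℓ`-primary components" / Thm. 17.18; Milne ADT I Thm. 1.8):
# `α²(Γ, M)`, `α¹(Γ, M)` bijective and `Ext³_{C_Γ}(M, C) = 0` for every FINITE `p`-PRIMARY `M`

Topic `Algebra/Homology`; namespace `Literature.Algebra.Homology.DiscreteRep`.  One `Prop`-valued
structure (`TateDualityHypothesesAt`, the `P`-class-formation data at one prime `p ∈ P`) and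
theorems; no definition with body, no named fact, no instance, no `sorry`.  The `p`-PRIMARY twin of
door-c4 g15's `DiscreteRepTateDuality` (`TateDualityHypotheses`, `tateDuality_finite`), reusing its
ladder (`ExtDualityLadder`), Shapiro column (`DiscreteRepShapiroPairing`) and presentation
(`DiscreteRepCoindPresentation`) verbatim, with Stage 1 replaced by
`DiscreteRepTrivialDualityPrimary.tateDuality_triv_primary`.

WHY (Harari §16.4, Thm. 17.2, Thm. 17.18).  For the restricted-ramification group `G_S` of a number
field and the `S`-idèle classes `C_S`, `(G_S, C_S)` is only a `P`-class formation: `inv_U` is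
injective with `H²(U, C_S){ℓ} ≅ ℚ_ℓ/ℤ_ℓ` for `ℓ ∈ P` only, and `Hʳ(U, C_S){ℓ}` (`r ≥ 3`) vanishes for
`ℓ ∈ P` only; so three fields of `TateDualityHypotheses (C_S) (inv_S)` (`invAt_bijective`,
`ext_triv_eq_zero_of_three_le`, `ext_eq_zero_of_four_le`) are not available, while Poitou–Tate
duality for `G_S` (Milne I Thm. 4.10, Harari Thm. 17.13) only ever needs `α^r(G_S, M)` for finite `M`
of order invertible in `𝒪_{k,S}` — prime by prime, for `p`-primary `M` with `p ∈ P`.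

THE STATEMENT.  `Γ` profinite, `C ∈ C_Γ = DiscreteRepCat ℤ Γ`, `inv : Ext²_{C_Γ}(ℤ, C) →+ Q`, a prime
`p`; **`TateDualityHypothesesAt p C inv`**: `Q` injective; at every open normal `U ≤ Γ`:
`inv_U := inv ∘ cores_U` INJECTIVE and every `p`-power-torsion element of `Q` in its range;
`Ext¹_U(ℤ, Res C) = 0`; `Ext¹_U(ℤ, ℤ) = 0`; `Extʳ_U(ℤ, Res C)` `p`-divisible for `r ≥ 2` and without
`p`-torsion for `r ≥ 3`; Milne's (b) at `p`: `α¹(U, ℤ/p^a)` bijective (`a ≥ 1`); and Lemma 1.9 at `p`: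
`Extʳ_Γ(M, C) = 0` for `r ≥ 4` and `M` finite killed by a power of `p`.  Conclusion
**`tateDuality_finite_primary`**: for every `M ∈ C_Γ` with finitely many vectors, all killed by `p^k`,
`α²(Γ, M)` and `α¹(Γ, M)` are bijective and `Ext³_{C_Γ}(M, C) = 0`; in particular
`adjointMap_one_injective_primary` (the input `hα` of Milne I 4.10 (b) for `G_S`).

PROOF.  Door-c4 g15's, word for word: `U` open normal acting trivially on `M`; the short exact
`0 → M → M_* → M″ → 0`, `M_* = Coind_U Res_U M`; `M_*` and `M″` are again finite and killed by `p^k`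
(`nsmul_id_obj_eq_zero`, `nsmul_id_eq_zero_of_epi`); the column `α^r(Γ, M_*) = α^r(U, Res_U M)`
(Shapiro) with `Res_U M ≅ triv_U M` (Stage 1 at `p`); then the ladder.

Written for the background sub-lane «PT-Ш-S-TC» of crux `stmt-BirchSwinnertonDyer-19032` (cell
bsd-eis, road «SUR-Λ», input D = Milne I Thm. 4.10 (a) for `G_S`, natural form): brick D0
«ENGINE-p», file 2 of 2.  HONEST FRAMING: homological algebra only — the `P`-class-formation
hypotheses are NOT discharged here (that is brick D2 for `(G_S, C_S, inv_S)`); no arithmetic statement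
and no case of BSD is proved.

## References
* D. Harari, *Galois Cohomology and Class Field Theory*, Universitext (2020), §16.3 Lemma 16.19 –
  Theorem 16.21, §16.4 (Remark 16.24), Thm. 17.2, Remark 17.1, Thm. 17.18. [Harari2020]
* J. S. Milne, *Arithmetic Duality Theorems* (2nd ed. 2006), I §1, Theorem 1.8 and its proof
  (pp. 21–23), Lemma 1.9; I §4. [MilneADT2006]
-/

noncomputable section

namespace Literature.Algebra.Homology

namespace DiscreteRep

open CategoryTheory CategoryTheory.Limits CategoryTheory.Abelian ExtDuality

/-! ## §0 Objects killed by an integer: `n • 𝟙 = 0` -/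

section Killed

variable {k Γ : Type} [CommRing k] [Group Γ] [TopologicalSpace Γ]

/-- `n • 𝟙_M = 0` when every vector of `M` is killed by `n`. [cite: Harari2020, §16.4] -/
theorem nsmul_id_eq_zero_of_forall (M : DiscreteRepCat k Γ) (n : ℕ)
    (hM : ∀ v : M.obj.V, n • v = 0) : n • 𝟙 M = 0 := by
  refine ObjectProperty.hom_ext _ (Rep.hom_ext (Representation.IntertwiningMap.ext
    (LinearMap.ext fun v => ?_)))
  change (n • 𝟙 M).hom.hom v = (0 : M ⟶ M).hom.hom v
  rw [nsmul_hom_hom_apply, Nat.cast_smul_eq_nsmul, hM]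
  rfl

/-- Every vector of `M` is killed by `n` when `n • 𝟙_M = 0`. [cite: Harari2020, §16.4] -/
theorem nsmul_eq_zero_of_nsmul_id_eq_zero (M : DiscreteRepCat k Γ) (n : ℕ) (hM : n • 𝟙 M = 0)
    (v : M.obj.V) : n • v = 0 := by
  have h : (n • 𝟙 M).hom.hom v = (0 : M ⟶ M).hom.hom v := by rw [hM]
  rw [nsmul_hom_hom_apply, Nat.cast_smul_eq_nsmul] at h
  exact h

/-- `n • 𝟙 = 0` is inherited by the target of an epimorphism. [cite: Harari2020, §16.4] -/
theorem nsmul_id_eq_zero_of_epi {M N : DiscreteRepCat k Γ} (g : M ⟶ N) [Epi g] (n : ℕ)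
    (hM : n • 𝟙 M = 0) : n • 𝟙 N = 0 := by
  rw [← cancel_epi g, Preadditive.comp_nsmul, Category.comp_id, comp_zero,
    ← Category.id_comp g, ← Preadditive.nsmul_comp, hM, zero_comp]

/-- `n • 𝟙 = 0` is preserved by an additive functor. [cite: Harari2020, §16.4] -/
theorem nsmul_id_obj_eq_zero {𝒟 : Type*} [Category 𝒟] [Preadditive 𝒟] (F : DiscreteRepCat k Γ ⥤ 𝒟)
    [F.Additive] {M : DiscreteRepCat k Γ} (n : ℕ) (hM : n • 𝟙 M = 0) : n • 𝟙 (F.obj M) = 0 := by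
  rw [← F.map_id, ← F.map_nsmul, hM, F.map_zero]

end Killed

/-! ## §1 The `P`-class-formation data at the prime `p` -/

section Setting

variable {Γ : Type} [Group Γ] [TopologicalSpace Γ] [IsTopologicalGroup Γ] [CompactSpace Γ]
  [TotallyDisconnectedSpace Γ] (p : ℕ) (C : DiscreteRepCat ℤ Γ) {Q : Type} [AddCommGroup Q]
  (inv : Ext (triv (k := ℤ) (Γ := Γ) ℤ) C 2 →+ Q)

/-- **The hypotheses of Tate's duality theorem AT THE PRIME `p`** for `(Γ, C, inv)` — the data of a
`P`-class formation with `p ∈ P` (Harari §16.4: the `inv_U` are only injective, with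
`H²(U, C){ℓ} ≅ ℚ_ℓ/ℤ_ℓ` for `ℓ ∈ P`): `p` is prime; `Q` is an injective `ℤ`-module; at every open normal
`U ≤ Γ`: `inv_U` INJECTIVE and every `p`-power-torsion element of `Q` is an `inv_U`
(`H²(U, C){p} ≅ Q{p}`); `Ext¹_U(ℤ, C) = 0` (`H¹(U, C) = 0`); `Ext¹_U(ℤ, ℤ) = 0`; `Extʳ_U(ℤ, C)`
`p`-divisible for `r ≥ 2` (`H²(U, C)` is `p`-divisible since `p^∞ ∣ #U`; the higher ones are prime-to-`p`
torsion) and without `p`-torsion for `r ≥ 3` (`Hʳ(U, C){p} = 0`, Lemma 16.20 at `p`); Milne's (b) at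
`p`: `α¹(U, ℤ/p^a)` bijective for `a ≥ 1`; and Lemma 1.9 at `p` over `Γ`: `Extʳ_Γ(M, C) = 0` for
`r ≥ 4` and `M` finite with `p^k • 𝟙_M = 0`.  Compare `TateDualityHypotheses` (all primes at once:
`inv_U` bijective, `Extʳ_U(ℤ, C) = 0` for `r ≥ 3`).
[cite: Harari2020, §16.4 Remark 16.24, §16.3 Theorem 16.21, Theorem 17.18][cite: MilneADT2006, I Theorem 1.8, Lemma 1.9] -/
structure TateDualityHypothesesAt : Prop where
  /-- `p` is a prime. -/
  prime : p.Prime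
  /-- `Q` is an injective `ℤ`-module. -/
  baer : Module.Baer ℤ Q
  /-- `inv_U` is injective. -/
  invAt_injective : ∀ U : OpenNormalSubgroup Γ, Function.Injective (invAt C inv U)
  /-- Every `p`-power-torsion element of `Q` is in the range of `inv_U`. -/
  exists_invAt_eq : ∀ (U : OpenNormalSubgroup Γ) (a : ℕ) (q : Q), p ^ a • q = 0 →
    ∃ x, invAt C inv U x = q
  /-- `Ext¹_U(ℤ, Res C) = 0`. -/
  ext_one_eq_zero : ∀ (U : OpenNormalSubgroup Γ)
    (x : Ext (triv (k := ℤ) (Γ := (U : Subgroup Γ)) ℤ) ((resD ℤ (U : Subgroup Γ)).obj C) 1), x = 0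
  /-- `Ext¹_U(ℤ, ℤ) = 0`. -/
  ext_one_triv_eq_zero : ∀ (U : OpenNormalSubgroup Γ)
    (y : Ext (triv (k := ℤ) (Γ := (U : Subgroup Γ)) ℤ) (triv (k := ℤ) (Γ := (U : Subgroup Γ)) ℤ) 1), y = 0
  /-- `Extʳ_U(ℤ, Res C)` is `p`-divisible for `r ≥ 2`. -/
  ext_triv_divisible : ∀ (U : OpenNormalSubgroup Γ) (r : ℕ), 2 ≤ r →
    ∀ x : Ext (triv (k := ℤ) (Γ := (U : Subgroup Γ)) ℤ) ((resD ℤ (U : Subgroup Γ)).obj C) r,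
      ∃ y, x = p • y
  /-- `Extʳ_U(ℤ, Res C)` has no `p`-torsion for `r ≥ 3`. -/
  ext_triv_eq_zero_of_nsmul_eq_zero : ∀ (U : OpenNormalSubgroup Γ) (r : ℕ), 3 ≤ r →
    ∀ x : Ext (triv (k := ℤ) (Γ := (U : Subgroup Γ)) ℤ) ((resD ℤ (U : Subgroup Γ)).obj C) r,
      p • x = 0 → x = 0
  /-- Milne's hypothesis (b) at `p`: `α¹(U, ℤ/p^a)` bijective. -/
  adjointBijective_one_zmod_pow : ∀ (U : OpenNormalSubgroup Γ) (a : ℕ), 0 < a →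
    AdjointBijective (invAt C inv U) (triv (k := ℤ) (Γ := (U : Subgroup Γ)) (ZMod (p ^ a)))
      (show 1 + 1 = 2 from rfl)
  /-- Lemma 1.9 at `p`: `Extʳ_Γ(M, C) = 0` for `r ≥ 4`, `M` finite killed by a power of `p`. -/
  ext_eq_zero_of_four_le : ∀ (M : DiscreteRepCat ℤ Γ), Finite M.obj.V → ∀ k : ℕ, p ^ k • 𝟙 M = 0 →
    ∀ r : ℕ, 4 ≤ r → ∀ x : Ext M C r, x = 0

variable {p C inv}

/-! ## §2 The column `α^r(Γ, Coind_U Res_U M) = α^r(U, Res_U M)` for `U` acting trivially on `M` -/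

omit [TotallyDisconnectedSpace Γ] in
/-- **The middle column of (1.9.1) at `p`**: for `M` finite killed by `p^k` and `U` open normal acting
trivially on `M`, `α²(Γ, M_*)` and `α¹(Γ, M_*)` are bijective and `Ext³(M_*, C) = 0`,
`M_* = Coind_U Res_U M` (Shapiro + Stage 1 at `p` on `Res_U M ≅ triv_U M`).
[cite: Harari2020, Proposition 16.18, Theorem 16.21 (proof)][cite: MilneADT2006, I Theorem 1.8 (proof, (1.9.1))] -/
theorem column_coindRes_primary (hyp : TateDualityHypothesesAt p C inv) (M : DiscreteRepCat ℤ Γ)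
    [Finite M.obj.V] {k : ℕ} (hM : p ^ k • 𝟙 M = 0)
    (U : OpenNormalSubgroup Γ) (hUM : ∀ u : Γ, u ∈ (U : Subgroup Γ) → ∀ x : M.obj.V, M.obj.ρ u x = x) :
    haveI := finiteIndex_of_openNormalSubgroup U
    AdjointBijective inv ((coindD ℤ (U : Subgroup Γ) U.toOpenSubgroup.isOpen).obj
        ((resD ℤ (U : Subgroup Γ)).obj M)) (show 0 + 2 = 2 from rfl) ∧
      AdjointBijective inv ((coindD ℤ (U : Subgroup Γ) U.toOpenSubgroup.isOpen).obj
        ((resD ℤ (U : Subgroup Γ)).obj M)) (show 1 + 1 = 2 from rfl) ∧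
      ∀ x : Ext ((coindD ℤ (U : Subgroup Γ) U.toOpenSubgroup.isOpen).obj
        ((resD ℤ (U : Subgroup Γ)).obj M)) C 3, x = 0 := by
  haveI := finiteIndex_of_openNormalSubgroup U
  -- Stage 1 at `p` for the open subgroup `U`, on the trivial module `M.V`
  have st := tateDuality_triv_primary_inst ((resD ℤ (U : Subgroup Γ)).obj C) (invAt C inv U) hyp.prime
    hyp.baer (hyp.invAt_injective U) (hyp.exists_invAt_eq U) (hyp.ext_one_eq_zero U)
    (hyp.ext_one_triv_eq_zero U) (hyp.ext_triv_divisible U) (hyp.ext_triv_eq_zero_of_nsmul_eq_zero U)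
    (hyp.adjointBijective_one_zmod_pow U) M.obj.V k (nsmul_eq_zero_of_nsmul_id_eq_zero M _ hM)
    (inst := M.obj.hV2)
  -- transport along `Res_U M ≅ triv_U M.V`
  let e := resTrivIso (k := ℤ) (U : Subgroup Γ) M hUM
  have r2 : AdjointBijective (invAt C inv U) ((resD ℤ (U : Subgroup Γ)).obj M)
      (show 0 + 2 = 2 from rfl) := (adjointBijective_iff_of_iso (invAt C inv U) e _).2 st.1
  have r1 : AdjointBijective (invAt C inv U) ((resD ℤ (U : Subgroup Γ)).obj M)
      (show 1 + 1 = 2 from rfl) := (adjointBijective_iff_of_iso (invAt C inv U) e _).2 st.2.1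
  have v3 : ∀ y : Ext ((resD ℤ (U : Subgroup Γ)).obj M) ((resD ℤ (U : Subgroup Γ)).obj C) 3, y = 0 :=
    fun y => ext_eq_zero_of_iso e (st.2.2 3 le_rfl) y
  -- Shapiro
  refine ⟨(adjointBijective_coind_iff (U : Subgroup Γ) U.toOpenSubgroup.isOpen C inv _ _).2
      ((adjointBijective_invAt_iff C inv U _ _).2 r2),
    (adjointBijective_coind_iff (U : Subgroup Γ) U.toOpenSubgroup.isOpen C inv _ _).2
      ((adjointBijective_invAt_iff C inv U _ _).2 r1), fun x => ?_⟩
  have Sh := ExtAdjunction.extAdjunctionAddEquiv (coindResAdj (U : Subgroup Γ) U.toOpenSubgroup.isOpen)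
    ((resD ℤ (U : Subgroup Γ)).obj M) C 3
  exact (AddEquiv.map_eq_zero_iff Sh).1 (v3 (Sh x))

/-! ## §3 The theorem -/

omit [TotallyDisconnectedSpace Γ] in
/-- `M″ = coker(M → Coind_U Res_U M)` is killed by `p^k` when `M` is.
[cite: MilneADT2006, I Theorem 1.8 (proof)] -/
theorem nsmul_id_coindResCokernel_eq_zero (M : DiscreteRepCat ℤ Γ) {n : ℕ} (hM : n • 𝟙 M = 0)
    (U : OpenNormalSubgroup Γ) :
    haveI := finiteIndex_of_openNormalSubgroup U
    n • 𝟙 (coindResSC (k := ℤ) (U : Subgroup Γ) U.toOpenSubgroup.isOpen M).X₃ = 0 := by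
  haveI := finiteIndex_of_openNormalSubgroup U
  exact nsmul_id_eq_zero_of_epi (coindResSC (k := ℤ) (U : Subgroup Γ) U.toOpenSubgroup.isOpen M).g n
    (nsmul_id_obj_eq_zero (resD ℤ (U : Subgroup Γ) ⋙ coindD ℤ (U : Subgroup Γ) U.toOpenSubgroup.isOpen)
      n hM)

/-- **`Ext³_{C_Γ}(M, C) = 0` for `M` finite killed by `p^k`** (row `r = 3`: `Ext³(M_*) = 0` by the
column, `Ext⁴(M″) = 0` by Lemma 1.9 at `p`). [cite: Harari2020, Theorem 16.21 (proof)][cite: MilneADT2006, I Theorem 1.8 (proof)] -/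
theorem ext_three_eq_zero_primary (hyp : TateDualityHypothesesAt p C inv) (M : DiscreteRepCat ℤ Γ)
    [Finite M.obj.V] {k : ℕ} (hM : p ^ k • 𝟙 M = 0) (x : Ext M C 3) : x = 0 := by
  obtain ⟨U, hUM⟩ := exists_openNormalSubgroup_forall_apply_eq (k := ℤ) M
  haveI := finiteIndex_of_openNormalSubgroup U
  have hS := coindResSC_shortExact (k := ℤ) (U : Subgroup Γ) U.toOpenSubgroup.isOpen M
  haveI : Finite (coindResSC (k := ℤ) (U : Subgroup Γ) U.toOpenSubgroup.isOpen M).X₃.obj.V :=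
    finite_coindResCokernel (U : Subgroup Γ) U.toOpenSubgroup.isOpen M hUM
  have col := column_coindRes_primary hyp M hM U hUM
  exact ext_eq_zero_of_ladder₁ hS C (show 1 + 3 = 4 from rfl) col.2.2
    (hyp.ext_eq_zero_of_four_le _ inferInstance k (nsmul_id_coindResCokernel_eq_zero M hM U) 4 le_rfl) x

/-- **`α²(Γ, M)` is surjective for `M` finite killed by `p^k`** (edge lemma: needs only `α²(Γ, M_*)`
surjective). [cite: Harari2020, Theorem 16.21 (proof)][cite: MilneADT2006, I Theorem 1.8 (proof)] -/
theorem adjointSurjective_two_primary (hyp : TateDualityHypothesesAt p C inv) (M : DiscreteRepCat ℤ Γ)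
    [Finite M.obj.V] {k : ℕ} (hM : p ^ k • 𝟙 M = 0) :
    AdjointSurjective inv M (show 0 + 2 = 2 from rfl) := by
  obtain ⟨U, hUM⟩ := exists_openNormalSubgroup_forall_apply_eq (k := ℤ) M
  haveI := finiteIndex_of_openNormalSubgroup U
  have hS := coindResSC_shortExact (k := ℤ) (U : Subgroup Γ) U.toOpenSubgroup.isOpen M
  have col := column_coindRes_primary hyp M hM U hUM
  exact adjointSurjective_two_of_ladder inv hS hyp.baer _ rfl col.1.2

/-- **`α²(Γ, M)` is injective for `M` finite killed by `p^k`** (edge lemma: `α²(M″)` surjective,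
`α²(M_*)` injective, `Ext³(M″) = 0`). [cite: Harari2020, Theorem 16.21 (proof)][cite: MilneADT2006, I Theorem 1.8 (proof)] -/
theorem adjointInjective_two_primary (hyp : TateDualityHypothesesAt p C inv) (M : DiscreteRepCat ℤ Γ)
    [Finite M.obj.V] {k : ℕ} (hM : p ^ k • 𝟙 M = 0) :
    AdjointInjective inv M (show 0 + 2 = 2 from rfl) := by
  obtain ⟨U, hUM⟩ := exists_openNormalSubgroup_forall_apply_eq (k := ℤ) M
  haveI := finiteIndex_of_openNormalSubgroup U
  have hS := coindResSC_shortExact (k := ℤ) (U : Subgroup Γ) U.toOpenSubgroup.isOpen M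
  haveI : Finite (coindResSC (k := ℤ) (U : Subgroup Γ) U.toOpenSubgroup.isOpen M).X₃.obj.V :=
    finite_coindResCokernel (U : Subgroup Γ) U.toOpenSubgroup.isOpen M hUM
  have h3 := nsmul_id_coindResCokernel_eq_zero M hM U
  have col := column_coindRes_primary hyp M hM U hUM
  exact adjointInjective_two_of_ladder inv hS hyp.baer _ rfl (adjointSurjective_two_primary hyp _ h3)
    col.1.1 (fun x => ext_three_eq_zero_primary hyp _ h3 x)

/-- **`α¹(Γ, M)` is surjective for `M` finite killed by `p^k`** (`α¹(M_*)` surjective, `α²(M″)`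
surjective, `α²(M_*)` injective). [cite: Harari2020, Theorem 16.21 (proof, (b))][cite: MilneADT2006, I Theorem 1.8 (proof, (b))] -/
theorem adjointSurjective_one_primary (hyp : TateDualityHypothesesAt p C inv) (M : DiscreteRepCat ℤ Γ)
    [Finite M.obj.V] {k : ℕ} (hM : p ^ k • 𝟙 M = 0) :
    AdjointSurjective inv M (show 1 + 1 = 2 from rfl) := by
  obtain ⟨U, hUM⟩ := exists_openNormalSubgroup_forall_apply_eq (k := ℤ) M
  haveI := finiteIndex_of_openNormalSubgroup U
  have hS := coindResSC_shortExact (k := ℤ) (U : Subgroup Γ) U.toOpenSubgroup.isOpen M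
  haveI : Finite (coindResSC (k := ℤ) (U : Subgroup Γ) U.toOpenSubgroup.isOpen M).X₃.obj.V :=
    finite_coindResCokernel (U : Subgroup Γ) U.toOpenSubgroup.isOpen M hUM
  have h3 := nsmul_id_coindResCokernel_eq_zero M hM U
  have col := column_coindRes_primary hyp M hM U hUM
  exact adjointSurjective_of_ladder inv hS hyp.baer (show 1 + 1 = 2 from rfl) (show 1 + 1 = 2 from rfl)
    (show 0 + 1 = 1 from rfl) (show 0 + 2 = 2 from rfl) col.2.1.2 (adjointSurjective_two_primary hyp _ h3)
    col.1.1

/-- **`α¹(Γ, M)` is injective for `M` finite killed by `p^k`** (`α¹(M″)` surjective, `α¹(M_*)`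
injective, `α²(M″)` injective). [cite: Harari2020, Theorem 16.21 (proof, (b))][cite: MilneADT2006, I Theorem 1.8 (proof, (b))] -/
theorem adjointInjective_one_primary (hyp : TateDualityHypothesesAt p C inv) (M : DiscreteRepCat ℤ Γ)
    [Finite M.obj.V] {k : ℕ} (hM : p ^ k • 𝟙 M = 0) :
    AdjointInjective inv M (show 1 + 1 = 2 from rfl) := by
  obtain ⟨U, hUM⟩ := exists_openNormalSubgroup_forall_apply_eq (k := ℤ) M
  haveI := finiteIndex_of_openNormalSubgroup U
  have hS := coindResSC_shortExact (k := ℤ) (U : Subgroup Γ) U.toOpenSubgroup.isOpen M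
  haveI : Finite (coindResSC (k := ℤ) (U : Subgroup Γ) U.toOpenSubgroup.isOpen M).X₃.obj.V :=
    finite_coindResCokernel (U : Subgroup Γ) U.toOpenSubgroup.isOpen M hUM
  have h3 := nsmul_id_coindResCokernel_eq_zero M hM U
  have col := column_coindRes_primary hyp M hM U hUM
  exact adjointInjective_of_ladder inv hS hyp.baer (show 1 + 1 = 2 from rfl) (show 1 + 1 = 2 from rfl)
    (show 0 + 1 = 1 from rfl) (show 0 + 2 = 2 from rfl) (adjointSurjective_one_primary hyp _ h3) col.2.1.1
    (adjointInjective_two_primary hyp _ h3)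

/-- **Tate's duality theorem at `p` in `Ext` form (Harari Thm. 16.21 restricted to `p`-primary
components, for finite `p`-primary modules; Milne ADT I Thm. 1.8 (a), (b)).**  Let `Γ` be profinite,
`C ∈ C_Γ`, `inv : Ext²_{C_Γ}(ℤ, C) →+ Q`, satisfying `TateDualityHypothesesAt p C inv`.  Then for
every `M ∈ C_Γ` with finitely many vectors, all killed by `p^k`, the Yoneda duality maps
`α²(Γ, M) : Ext²(M, C) → Hom(Hom(ℤ, M), Q)` and `α¹(Γ, M) : Ext¹(M, C) → Hom(Ext¹(ℤ, M), Q)` are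
bijective and `Ext³_{C_Γ}(M, C) = 0`.
[cite: Harari2020, §16.3 Theorem 16.21, §16.4, Theorem 17.18][cite: MilneADT2006, I Theorem 1.8] -/
theorem tateDuality_finite_primary (hyp : TateDualityHypothesesAt p C inv) (M : DiscreteRepCat ℤ Γ)
    [Finite M.obj.V] (k : ℕ) (hM : ∀ v : M.obj.V, p ^ k • v = 0) :
    AdjointBijective inv M (show 0 + 2 = 2 from rfl) ∧ AdjointBijective inv M (show 1 + 1 = 2 from rfl) ∧
      ∀ x : Ext M C 3, x = 0 := by
  have hM' : p ^ k • 𝟙 M = 0 := nsmul_id_eq_zero_of_forall M _ hM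
  exact ⟨⟨adjointInjective_two_primary hyp M hM', adjointSurjective_two_primary hyp M hM'⟩,
    ⟨adjointInjective_one_primary hyp M hM', adjointSurjective_one_primary hyp M hM'⟩,
    ext_three_eq_zero_primary hyp M hM'⟩

/-- **The input of Poitou–Tate for `G_S` (Milne I 4.10 (b), `r = 1`, at `p`)**: under the hypotheses,
for `M` finite killed by `p^k` the map `Ext¹_{C_Γ}(M, C) → Hom(Ext¹_{C_Γ}(ℤ, M), Q)`,
`x ↦ (y ↦ inv (y ∘ x))`, is INJECTIVE.
[cite: Harari2020, Theorem 17.18][cite: MilneADT2006, I Theorem 1.8 (b) and Theorem 4.10 (proof)] -/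
theorem adjointMap_one_injective_primary (hyp : TateDualityHypothesesAt p C inv) (M : DiscreteRepCat ℤ Γ)
    [Finite M.obj.V] (k : ℕ) (hM : ∀ v : M.obj.V, p ^ k • v = 0) :
    Function.Injective (adjointMap inv M (show 1 + 1 = 2 from rfl)) :=
  (tateDuality_finite_primary hyp M k hM).2.1.1

end Setting

end DiscreteRep

end Literature.Algebra.Homology
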